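/-
Origin: expansion seat `prover-pub-hodgecm-mc-binder-1-0`, handover #7 2026-08-18T18:53Z md5 5a3524e8c2c11f0b52abbf49105c9263 (NEW, 500 l.; rewrites import McB1.IchinoFockKTypes -> HodgeCM.Literature.IchinoFockKTypes x1; also imports tree HodgeCM.PerL34.FockKTypes; audited names: HodgeCM.Model.Binders.IchinoExplicitDefLine.lemma_7_10_explicitPosLine, HodgeCM.Model.Binders.IchinoExplicitDefLine.lemma_7_10_explicitNegLine, HodgeCM.Model.Binders.IchinoExplicitDefLine (`HOME/mc/pub-hodgecm-mc-binder-1/lean/McB1/IchinoExplicitDefLine.lean`, md5 5a3524e8, 500 lines);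
landed by the packager successor (mc-unitary-1-g3, gen-8 kit) in gate run 32 as `HodgeCM/Model/Binders/IchinoExplicitDefLine.lean` (import ^import McB1\.IchinoFockKTypes[ \t]*$→import HodgeCM.Literature.IchinoFockKTypes ×1).
-/
/-
Copyright (c) 2026 the pub-hodgecm formalisation cell (harness21).  New file, not vendored.
Origin: HOME/mc/pub-hodgecm-mc-binder-1/lean/McB1/IchinoExplicitDefLine.lean — session prover-pub-hodgecm-mc-binder-1-0
(unit pub-hodgecm-mc-binder-1, MODEL-CONSTRUCTION sub-cell, BINDER PROVER hbr/hQ/hch; MODEL-DAG node W3-K).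
Intended final place: `HodgeCM/Model/Binders/IchinoExplicitDefLine.lean`.  Imports: the LANDED `HodgeCM.PerL34.FockKTypes`
(pv12, run 20) and ONE rewrite `McB1.IchinoFockKTypes` ↦ `HodgeCM.Literature.IchinoFockKTypes`.
KIND: KERNEL — [Ich22] Lemma 7.10 PROVED for the package's explicit Fock models of a hermitian LINE against the
COMPACT group `U(3)` (the places `b ≠ ι₁`); nothing of PerL / QW8 / the 2001 programme is used.
-/
import Summits.HodgeConjecture.HodgeCM.PerL34.FockKTypes
import Summits.HodgeConjecture.HodgeCM.Literature.IchinoFockKTypes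

set_option autoImplicit false

/-!
# W3-K, second file: Ichino's Lemma 7.10 HOLDS in the explicit Fock models `ℂ[z₁,z₂,z₃]` of `(U(1), U(3))` — both signs

Companion of `HodgeCM.Model.Binders.IchinoExplicitLine` (the place `ι₁`).  At a real place `b ≠ ι₁` the group
`G_U(L_{0,b}) ≅ U(3)` is COMPACT, so `𝔭′ = 0` and the joint harmonics are the WHOLE Fock space ([Ad07] Def 6.1:
`𝓗(K) = {P | X·P = 0 ∀ X ∈ 𝔭′⁻}` with `𝔭′⁻ = 0`); the `K × K′ = U(1) × U(3)`-structure of pv12's explicit model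
`HodgeCM.PerL34.Fock.DefModel = ℂ[z₁,z₂,z₃]` (`FockKTypes.lean` (F4)) is: torus of `U(3)` by `weightOp (defTorWt a)`,
raising operators `z_a ∂_{z_b}` (`a < b`), and `U(W) = U(1)` by the total degree — for a POSITIVE line (`(p,q) = (1,0)`,
the `z_a` transform like the standard representation); for a NEGATIVE line (`(p,q) = (0,1)`) the CONJUGATE model: the
same ring with the dual action (torus weights `−e_a`, raising operators `−z_b ∂_{z_a}`, `U(1)` by minus the degree)
— PerL v5 l. 499 "for a negative line the model is the conjugate one", (F4) docstring of `FockKTypes`.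

Proved here (complete proofs, nothing cited as a hypothesis):
* `isHWPos_iff` / `isHWNeg_iff` — the joint highest-weight vectors are exactly `c·z₁^a` (weights: degree `a`, torus
  `(a,0,0)`) resp. `c·z₃^d` (weights: `−d`, torus `(0,0,−d)`);
* `explicitPosLine S hr`, `explicitNegLine S hr : FockHarmonics S` — the [Ich22] dictionaries of the two models for a
  datum with `r = 3` (the §4.1 exponents `m₀, n₀` as the printed shifts `(r−s)/2 + m₀/2`, `(p−q)/2 + n₀/2`);
* **`lemma_7_10_explicitPosLine`** (`(p,q;r,s) = (1,0;3,0)`) and **`lemma_7_10_explicitNegLine`** (`(0,1;3,0)`):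
  Ichino's Lemma 7.10 is a THEOREM for these models.
With `HodgeCM.Literature.IchinoFockKTypesLines.corresponds_trivial_iff_posLine/negLine` this gives PerL's N26 sentences
("the vacuum line; `𝟏_{U(3)}` occurs iff `m = ∓1`") with NO citation left at the places `b ≠ ι₁` for LINES, modulo the
W3-B identification of the constructed `ω_{W_i,b}` with this model.
-/

noncomputable section

namespace HodgeCM
namespace Model
namespace Binders
namespace IchinoExplicitDefLine

open MvPolynomial Finsupp
open HodgeCM.PerL34.Fock
open HodgeCM.Literature.Ichino2022 HodgeCM.Literature.Ichino2022.FockHarmonics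
  HodgeCM.Literature.Ichino2022.HarmonicParam

/-! ## §0 Weights on `ℂ[z₁,z₂,z₃]` -/

/-- (Ported verbatim from the HodgeCMPerL package; no docstring in the source.) -/
theorem wt_defTorWt (a : Fin 3) (m : Fin 3 →₀ ℕ) : wt (defTorWt a) m = (m a : ℤ) := by
  simp only [wt, defTorWt, Fin.sum_univ_three]
  fin_cases a <;> simp

/-- total degree weight (`U(W) = U(1)` on a positive line: every `z_a ↦ u^{+1}`). -/
def degWt : Fin 3 → ℤ := fun _ => 1

/-- (Ported verbatim from the HodgeCMPerL package; no docstring in the source.) -/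
theorem wt_degWt (m : Fin 3 →₀ ℕ) : wt degWt m = (m 0 : ℤ) + m 1 + m 2 := by
  simp only [wt, degWt, Fin.sum_univ_three]; ring

/-- The exponent vector `(n₀, n₁, n₂)`. -/
def expo3 (n₀ n₁ n₂ : ℕ) : Fin 3 →₀ ℕ := single 0 n₀ + single 1 n₁ + single 2 n₂

/-- (Ported verbatim from the HodgeCMPerL package; no docstring in the source.) -/
@[simp] theorem expo3_zero (n₀ n₁ n₂ : ℕ) : expo3 n₀ n₁ n₂ 0 = n₀ := by simp [expo3]
/-- (Ported verbatim from the HodgeCMPerL package; no docstring in the source.) -/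
@[simp] theorem expo3_one (n₀ n₁ n₂ : ℕ) : expo3 n₀ n₁ n₂ 1 = n₁ := by simp [expo3]
/-- (Ported verbatim from the HodgeCMPerL package; no docstring in the source.) -/
@[simp] theorem expo3_two (n₀ n₁ n₂ : ℕ) : expo3 n₀ n₁ n₂ 2 = n₂ := by simp [expo3]

/-- (Ported verbatim from the HodgeCMPerL package; no docstring in the source.) -/
theorem fin3_ext {m m' : Fin 3 →₀ ℕ} (h0 : m 0 = m' 0) (h1 : m 1 = m' 1) (h2 : m 2 = m' 2) : m = m' := by
  ext ⟨i, hi⟩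
  interval_cases i
  · exact h0
  · exact h1
  · exact h2

/-- (Ported verbatim from the HodgeCMPerL package; no docstring in the source.) -/
theorem X_pow_eq_expo3_zero (a : ℕ) : (X 0 : DefModel) ^ a = monomial (expo3 a 0 0) 1 := by
  rw [X_pow_eq_monomial, expo3]; simp

/-- (Ported verbatim from the HodgeCMPerL package; no docstring in the source.) -/
theorem X_pow_eq_expo3_two (d : ℕ) : (X 2 : DefModel) ^ d = monomial (expo3 0 0 d) 1 := by
  rw [X_pow_eq_monomial, expo3]; simp

/-- A joint torus weight vector with weights `(n₀,n₁,n₂)` is a multiple of the monomial `z^{(n₀,n₁,n₂)}`. -/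
theorem eq_smul_monomial_of_torus {f : DefModel} {n₀ n₁ n₂ : ℤ}
    (h0 : weightOp (defTorWt 0) f = (n₀ : ℂ) • f) (h1 : weightOp (defTorWt 1) f = (n₁ : ℂ) • f)
    (h2 : weightOp (defTorWt 2) f = (n₂ : ℂ) • f) (hf : f ≠ 0) :
    0 ≤ n₀ ∧ 0 ≤ n₁ ∧ 0 ≤ n₂ ∧
      f = coeff (expo3 n₀.toNat n₁.toNat n₂.toNat) f • monomial (expo3 n₀.toNat n₁.toNat n₂.toNat) 1 := by
  classical
  have key : ∀ m ∈ f.support, (m 0 : ℤ) = n₀ ∧ (m 1 : ℤ) = n₁ ∧ (m 2 : ℤ) = n₂ := by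
    intro m hm
    refine ⟨?_, ?_, ?_⟩
    · have := wt_eq_of_weightOp_eq_smul h0 hm; rwa [wt_defTorWt] at this
    · have := wt_eq_of_weightOp_eq_smul h1 hm; rwa [wt_defTorWt] at this
    · have := wt_eq_of_weightOp_eq_smul h2 hm; rwa [wt_defTorWt] at this
  obtain ⟨m₀, hm₀⟩ : ∃ m, m ∈ f.support := by
    by_contra hno
    apply hf
    ext m
    rw [coeff_zero]
    by_contra hne
    exact hno ⟨m, MvPolynomial.mem_support_iff.mpr hne⟩
  obtain ⟨k0, k1, k2⟩ := key m₀ hm₀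
  refine ⟨by omega, by omega, by omega, ?_⟩
  have hM : ∀ m ∈ f.support, m = expo3 n₀.toNat n₁.toNat n₂.toNat := by
    intro m hm
    obtain ⟨j0, j1, j2⟩ := key m hm
    refine fin3_ext ?_ ?_ ?_
    · rw [expo3_zero]; omega
    · rw [expo3_one]; omega
    · rw [expo3_two]; omega
  ext m
  rw [coeff_smul, coeff_monomial, smul_eq_mul]
  by_cases hm : expo3 n₀.toNat n₁.toNat n₂.toNat = m
  · rw [if_pos hm, mul_one, hm]
  · rw [if_neg hm, mul_zero]
    by_contra hne
    exact hm (hM m (MvPolynomial.mem_support_iff.mpr hne)).symm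

/-- `z_a ∂_b` on a monomial vanishes iff `z_b` does not occur (`c ≠ 0`). -/
theorem X_mul_pderiv_monomial_eq_zero_iff (a b : Fin 3) (m : Fin 3 →₀ ℕ) (c : ℂ) (hc : c ≠ 0) :
    (X a : DefModel) * pderiv b (monomial m c) = 0 ↔ m b = 0 := by
  classical
  rw [mul_eq_zero, pderiv_monomial]
  constructor
  · rintro (h | h)
    · exact absurd h (X_ne_zero _)
    · rw [monomial_eq_zero] at h
      rcases mul_eq_zero.mp h with h' | h'
      · exact absurd h' hc
      · exact_mod_cast h'
  · intro h
    right
    rw [h]; simp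

/-- Weights of a monomial. -/
theorem weightOp_monomial_expo3 (n₀ n₁ n₂ : ℕ) (c : ℂ) :
    weightOp (defTorWt 0) (monomial (expo3 n₀ n₁ n₂) c) = ((n₀ : ℤ) : ℂ) • monomial (expo3 n₀ n₁ n₂) c ∧
    weightOp (defTorWt 1) (monomial (expo3 n₀ n₁ n₂) c) = ((n₁ : ℤ) : ℂ) • monomial (expo3 n₀ n₁ n₂) c ∧
    weightOp (defTorWt 2) (monomial (expo3 n₀ n₁ n₂) c) = ((n₂ : ℤ) : ℂ) • monomial (expo3 n₀ n₁ n₂) c ∧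
    weightOp degWt (monomial (expo3 n₀ n₁ n₂) c) = (((n₀ : ℤ) + n₁ + n₂ : ℤ) : ℂ) • monomial (expo3 n₀ n₁ n₂) c := by
  refine ⟨?_, ?_, ?_, ?_⟩
  · rw [weightOp_monomial, wt_defTorWt]; simp
  · rw [weightOp_monomial, wt_defTorWt]; simp
  · rw [weightOp_monomial, wt_defTorWt]; simp
  · rw [weightOp_monomial, wt_degWt]; simp

/-! ## §1 The positive line: `ℂ[z₁,z₂,z₃]` with the standard `U(3)` and `U(1)` by the degree -/

/-- **Joint `U(1) × U(3)`-highest-weight vector of the POSITIVE-line model**: non-zero, `U(1)`-weight `k` (the degree),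
`U(3)`-torus weights `(t₀,t₁,t₂)`, killed by the three raising operators `z_a ∂_b` (`a < b`).  (Every vector is
harmonic: `𝔭′ = 0` for the compact `U(3)`.) -/
structure IsHWPos (f : DefModel) (k t₀ t₁ t₂ : ℤ) : Prop where
  ne : f ≠ 0
  deg : weightOp degWt f = (k : ℂ) • f
  tor0 : weightOp (defTorWt 0) f = (t₀ : ℂ) • f
  tor1 : weightOp (defTorWt 1) f = (t₁ : ℂ) • f
  tor2 : weightOp (defTorWt 2) f = (t₂ : ℂ) • f
  e01 : (X 0 : DefModel) * pderiv 1 f = 0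
  e02 : (X 0 : DefModel) * pderiv 2 f = 0
  e12 : (X 1 : DefModel) * pderiv 2 f = 0

/-- **Classification, positive line**: the joint highest-weight vectors are exactly `c·z₁^a`, `a ≥ 0`, with degree `a`
and torus weights `(a,0,0)` — the `U(3)`-types `Sym^a` ([Ich22] L7.10 at `(1,0;3,0)`: `μ′ = (a,0,0) + shift`). -/
theorem isHWPos_iff (f : DefModel) (k t₀ t₁ t₂ : ℤ) :
    IsHWPos f k t₀ t₁ t₂ ↔
      ∃ (a : ℕ) (c : ℂ), c ≠ 0 ∧ f = c • (X 0 : DefModel) ^ a ∧ k = a ∧ t₀ = a ∧ t₁ = 0 ∧ t₂ = 0 := by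
  classical
  constructor
  · intro H
    obtain ⟨ht₀, ht₁, ht₂, hf⟩ := eq_smul_monomial_of_torus H.tor0 H.tor1 H.tor2 H.ne
    set c := coeff (expo3 t₀.toNat t₁.toNat t₂.toNat) f with hc_def
    have hc : c ≠ 0 := by
      intro h0; apply H.ne; rw [hf, h0, zero_smul]
    have hfm : f = monomial (expo3 t₀.toNat t₁.toNat t₂.toNat) c := by
      rw [hf, smul_monomial, smul_eq_mul, mul_one]
    have h1 : t₁.toNat = 0 := by
      have h := H.e01
      rw [hfm, X_mul_pderiv_monomial_eq_zero_iff _ _ _ _ hc] at h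
      simpa using h
    have h2 : t₂.toNat = 0 := by
      have h := H.e02
      rw [hfm, X_mul_pderiv_monomial_eq_zero_iff _ _ _ _ hc] at h
      simpa using h
    have hk : k = t₀ + t₁ + t₂ := by
      have h := H.deg
      rw [hfm, (weightOp_monomial_expo3 _ _ _ c).2.2.2] at h
      have hmon : (monomial (expo3 t₀.toNat t₁.toNat t₂.toNat) c : DefModel) ≠ 0 := by
        rw [Ne, monomial_eq_zero]; exact hc
      have := smul_left_injective ℂ hmon h
      have h' : ((t₀.toNat : ℤ) + t₁.toNat + t₂.toNat : ℤ) = k := by exact_mod_cast this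
      omega
    refine ⟨t₀.toNat, c, hc, ?_, by omega, by omega, by omega, by omega⟩
    rw [hfm, X_pow_eq_expo3_zero, smul_monomial, smul_eq_mul, mul_one, h1, h2]
  · rintro ⟨a, c, hc, rfl, rfl, rfl, rfl, rfl⟩
    have hm : c • (X 0 : DefModel) ^ a = monomial (expo3 a 0 0) c := by
      rw [X_pow_eq_expo3_zero, smul_monomial, smul_eq_mul, mul_one]
    obtain ⟨w0, w1, w2, wd⟩ := weightOp_monomial_expo3 a 0 0 c
    refine ⟨?_, ?_, ?_, ?_, ?_, ?_, ?_, ?_⟩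
    · rw [hm, Ne, monomial_eq_zero]; exact hc
    · rw [hm, wd]; norm_num
    · rw [hm, w0]
    · rw [hm, w1]; norm_num
    · rw [hm, w2]; norm_num
    · rw [hm, X_mul_pderiv_monomial_eq_zero_iff _ _ _ _ hc]; simp
    · rw [hm, X_mul_pderiv_monomial_eq_zero_iff _ _ _ _ hc]; simp
    · rw [hm, X_mul_pderiv_monomial_eq_zero_iff _ _ _ _ hc]; simp

/-! ## §2 The negative line: the conjugate model (dual `U(3)`-action, `U(1)` by minus the degree) -/

/-- **Joint highest-weight vector of the NEGATIVE-line (conjugate) model**: `U(1)`-weight `k` with the degree acting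
by `−1` (so `k = −deg`), `U(3)`-torus weights `(t₀,t₁,t₂)` = MINUS the exponents, killed by the raising operators of
the DUAL representation, which are `−z_b ∂_a` (`a < b`) on the dual coordinates. -/
structure IsHWNeg (f : DefModel) (k t₀ t₁ t₂ : ℤ) : Prop where
  ne : f ≠ 0
  deg : weightOp degWt f = (-k : ℂ) • f
  tor0 : weightOp (defTorWt 0) f = (-t₀ : ℂ) • f
  tor1 : weightOp (defTorWt 1) f = (-t₁ : ℂ) • f
  tor2 : weightOp (defTorWt 2) f = (-t₂ : ℂ) • f
  e01 : (X 1 : DefModel) * pderiv 0 f = 0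
  e02 : (X 2 : DefModel) * pderiv 0 f = 0
  e12 : (X 2 : DefModel) * pderiv 1 f = 0

/-- **Classification, negative line**: the joint highest-weight vectors are exactly `c·z₃^d`, `d ≥ 0`, with
`U(1)`-weight `−d` and torus weights `(0,0,−d)` ([Ich22] L7.10 at `(0,1;3,0)`: `μ′ = (0,0,d′) + shift`, `d′ ≤ 0`). -/
theorem isHWNeg_iff (f : DefModel) (k t₀ t₁ t₂ : ℤ) :
    IsHWNeg f k t₀ t₁ t₂ ↔
      ∃ (d : ℕ) (c : ℂ), c ≠ 0 ∧ f = c • (X 2 : DefModel) ^ d ∧ k = -(d : ℤ) ∧ t₀ = 0 ∧ t₁ = 0 ∧ t₂ = -(d : ℤ) := by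
  classical
  constructor
  · intro H
    have h0' : weightOp (defTorWt 0) f = ((-t₀ : ℤ) : ℂ) • f := by rw [H.tor0]; push_cast; rfl
    have h1' : weightOp (defTorWt 1) f = ((-t₁ : ℤ) : ℂ) • f := by rw [H.tor1]; push_cast; rfl
    have h2' : weightOp (defTorWt 2) f = ((-t₂ : ℤ) : ℂ) • f := by rw [H.tor2]; push_cast; rfl
    obtain ⟨ht₀, ht₁, ht₂, hf⟩ := eq_smul_monomial_of_torus h0' h1' h2' H.ne
    set c := coeff (expo3 (-t₀).toNat (-t₁).toNat (-t₂).toNat) f with hc_def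
    have hc : c ≠ 0 := by
      intro h0; apply H.ne; rw [hf, h0, zero_smul]
    have hfm : f = monomial (expo3 (-t₀).toNat (-t₁).toNat (-t₂).toNat) c := by
      rw [hf, smul_monomial, smul_eq_mul, mul_one]
    have h0 : (-t₀).toNat = 0 := by
      have h := H.e01
      rw [hfm, X_mul_pderiv_monomial_eq_zero_iff _ _ _ _ hc] at h
      simpa using h
    have h1 : (-t₁).toNat = 0 := by
      have h := H.e12
      rw [hfm, X_mul_pderiv_monomial_eq_zero_iff _ _ _ _ hc] at h
      simpa using h
    have hk : -k = -t₀ + -t₁ + -t₂ := by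
      have h := H.deg
      rw [hfm, (weightOp_monomial_expo3 _ _ _ c).2.2.2] at h
      have hmon : (monomial (expo3 (-t₀).toNat (-t₁).toNat (-t₂).toNat) c : DefModel) ≠ 0 := by
        rw [Ne, monomial_eq_zero]; exact hc
      have := smul_left_injective ℂ hmon h
      have h' : ((((-t₀).toNat : ℤ) + (-t₁).toNat + (-t₂).toNat : ℤ) : ℂ) = ((-k : ℤ) : ℂ) := by
        rw [this]; push_cast; rfl
      have h'' : (((-t₀).toNat : ℤ) + (-t₁).toNat + (-t₂).toNat : ℤ) = -k := by exact_mod_cast h'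
      omega
    refine ⟨(-t₂).toNat, c, hc, ?_, by omega, by omega, by omega, by omega⟩
    rw [hfm, X_pow_eq_expo3_two, smul_monomial, smul_eq_mul, mul_one, h0, h1]
  · rintro ⟨d, c, hc, rfl, rfl, rfl, rfl, rfl⟩
    have hm : c • (X 2 : DefModel) ^ d = monomial (expo3 0 0 d) c := by
      rw [X_pow_eq_expo3_two, smul_monomial, smul_eq_mul, mul_one]
    obtain ⟨w0, w1, w2, wd⟩ := weightOp_monomial_expo3 0 0 d c
    refine ⟨?_, ?_, ?_, ?_, ?_, ?_, ?_, ?_⟩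
    · rw [hm, Ne, monomial_eq_zero]; exact hc
    · rw [hm, wd]; norm_num
    · rw [hm, w0]; norm_num
    · rw [hm, w1]; norm_num
    · rw [hm, w2]; norm_num
    · rw [hm, X_mul_pderiv_monomial_eq_zero_iff _ _ _ _ hc]; simp
    · rw [hm, X_mul_pderiv_monomial_eq_zero_iff _ _ _ _ hc]; simp
    · rw [hm, X_mul_pderiv_monomial_eq_zero_iff _ _ _ _ hc]; simp

/-! ## §3 The two `FockHarmonics` dictionaries and Ichino's Lemma 7.10 as THEOREMS -/

section Dictionary

/-- Parameters of Lemma 7.10 with empty `c`, `d`… strings except the ones named: `p⁺ = pp`, `q⁻ = qm`, all others `0`. -/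
def defParam (S : SplittingDatum) (pp qm : ℕ) (hpp : pp ≤ 1) (hqm : qm ≤ 1) (hp : pp ≤ S.p) (hq : qm ≤ S.q)
    (hr : pp + qm ≤ S.r) (a : Fin pp → ℤ) (d : Fin qm → ℤ) (a_pos : ∀ i, 0 < a i) (d_neg : ∀ j, d j < 0) :
    HarmonicParam S where
  pp := pp
  pm := 0
  qp := 0
  qm := qm
  a := a
  b := Fin.elim0
  c := Fin.elim0
  d := d
  a_anti := fun i j _ => by
    have : i = j := Fin.ext (by have := i.isLt; have := j.isLt; omega)
    rw [this]
  b_anti := fun i => i.elim0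
  c_anti := fun i => i.elim0
  d_anti := fun i j _ => by
    have : i = j := Fin.ext (by have := i.isLt; have := j.isLt; omega)
    rw [this]
  a_pos := a_pos
  b_neg := fun i => i.elim0
  c_pos := fun i => i.elim0
  d_neg := d_neg
  hp := by omega
  hq := by omega
  hr := hr
  hs := by omega

/-- **The [Ich22] dictionary of the positive-line model against `U(3)`** (`r = 3`): `μ ⊠ μ′` corresponds iff a joint
highest-weight vector of the explicit model has the polynomial weights `(μ; μ′)` minus the printed vacuum shifts. -/
def explicitPosLine (S : SplittingDatum) (hr : S.r = 3) : FockHarmonics S where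
  corresponds μ μ' := ∃ (f : DefModel) (k t₀ t₁ t₂ : ℤ), IsHWPos f k t₀ t₁ t₂ ∧
    (∀ i, μ.1 i = (k : ℚ) + ((S.r : ℚ) - S.s) / 2 + (S.m₀ : ℚ) / 2) ∧
    μ'.1 ⟨0, by omega⟩ = (t₀ : ℚ) + ((S.p : ℚ) - S.q) / 2 + (S.n₀ : ℚ) / 2 ∧
    μ'.1 ⟨1, by omega⟩ = (t₁ : ℚ) + ((S.p : ℚ) - S.q) / 2 + (S.n₀ : ℚ) / 2 ∧
    μ'.1 ⟨2, by omega⟩ = (t₂ : ℚ) + ((S.p : ℚ) - S.q) / 2 + (S.n₀ : ℚ) / 2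

/-- **The [Ich22] dictionary of the negative-line (conjugate) model against `U(3)`.** -/
def explicitNegLine (S : SplittingDatum) (hr : S.r = 3) : FockHarmonics S where
  corresponds μ μ' := ∃ (f : DefModel) (k t₀ t₁ t₂ : ℤ), IsHWNeg f k t₀ t₁ t₂ ∧
    (∀ j, μ.2 j = (k : ℚ) + ((S.s : ℚ) - S.r) / 2 + (S.m₀ : ℚ) / 2) ∧
    μ'.1 ⟨0, by omega⟩ = (t₀ : ℚ) + ((S.p : ℚ) - S.q) / 2 + (S.n₀ : ℚ) / 2 ∧
    μ'.1 ⟨1, by omega⟩ = (t₁ : ℚ) + ((S.p : ℚ) - S.q) / 2 + (S.n₀ : ℚ) / 2 ∧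
    μ'.1 ⟨2, by omega⟩ = (t₂ : ℚ) + ((S.p : ℚ) - S.q) / 2 + (S.n₀ : ℚ) / 2

/-- An index of `Fin S.r`, `S.r = 3`, is `0`, `1` or `2`. -/
theorem fin_r_cases {S : SplittingDatum} (hr : S.r = 3) (i : Fin S.r) :
    i = ⟨0, by omega⟩ ∨ i = ⟨1, by omega⟩ ∨ i = ⟨2, by omega⟩ := by
  have hi : i.val = 0 ∨ i.val = 1 ∨ i.val = 2 := by have := i.isLt; omega
  rcases hi with hi | hi | hi
  · exact Or.inl (Fin.ext hi)
  · exact Or.inr (Or.inl (Fin.ext hi))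
  · exact Or.inr (Or.inr (Fin.ext hi))


-- port_pkg: scope closed for this part
end Dictionary
end IchinoExplicitDefLine
end Binders
end Model
end HodgeCM
end
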